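import Mathlib
import Summits.Ventures.PercRepro2.Defs
import Summits.Ventures.PercRepro2.Independence
import Summits.Ventures.PercRepro2.Harris
import Summits.Ventures.PercRepro2.Graph
import Summits.Ventures.PercRepro2.Exploration
import Summits.Ventures.PercRepro2.Induced
import Summits.Ventures.PercRepro2.R1Rung
import Summits.Ventures.PercRepro2.CC2Rung

/-!
# Row 2′MONO-T: the monotone potential of the first rung (blind cell PercRepro2, typer-1; mine-c g3
MINE-C.md §10.8 / §10.11 (d); lead g11 CONJECTURES v2.99p — statement of record = (MONO-u) [v ∈ e]
+ (MONO-T³) [all v]; engine D57/D61 n = 6 FULL 855,900 steps, n = 7 3,089,280 steps, 0 violations;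
the all-v exponent-2 form is NEG-63)

With the rung slack `S(T) = F₁ᴬᴮ P₀² − P₀ (F₀ᴬ F₁ᴮ + F₁ᴬ F₀ᴮ) + F₀ᴬ F₀ᴮ P₁ = P₁ P₀² Φ(T)`
(`TwoSetRung.CC2` is `0 ≤ S(T)`), `Ψ_k(T) = P₁(T)^k Φ(T) = P₁(T)^{k−1} S(T) / P₀(T)²`:

* **`MonoU`** (`Ψ₂` non-increasing under `T → T ∪ {v}`, cleared by `P₀(T)² P₀(T′)²`):
  `P₁(T′) S(T′) P₀(T)² ≤ P₁(T) S(T) P₀(T′)²` — the row of record for `v` an endpoint of `e`;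
* **`MonoT3`** (`Ψ₃` non-increasing): `P₁(T′)² S(T′) P₀(T)² ≤ P₁(T)² S(T) P₀(T′)²` — for every `v`.
-/

namespace Summit.Ventures.PercRepro2

namespace MonoT

open TwoSetRung

variable {V : Type*} {E : Type*} [Fintype E] [DecidableEq E] [DecidableEq V]
  {R : Type*} [Field R] [LinearOrder R] [IsStrictOrderedRing R]

section Defs

variable (p : E → R) (ends : E → Sym2 V) (e : E) (s : V) (A B : Finset V)

/-- The rung slack `S(T) = F₁ᴬᴮ P₀² − P₀ (F₀ᴬ F₁ᴮ + F₁ᴬ F₀ᴮ) + F₀ᴬ F₀ᴮ P₁` (so that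
`TwoSetRung.CC2 p ends e s A B T T ↔ 0 ≤ S(T)`). -/
noncomputable def rungSlack (T : Finset V) : R :=
  massF (Function.update p e 1) ends s (A ∪ B) T * massP (Function.update p e 0) ends s T ^ 2 -
    massP (Function.update p e 0) ends s T *
      (massF (Function.update p e 0) ends s A T * massF (Function.update p e 1) ends s B T +
        massF (Function.update p e 1) ends s A T * massF (Function.update p e 0) ends s B T) +
    massF (Function.update p e 0) ends s A T * massF (Function.update p e 0) ends s B T *
      massP (Function.update p e 1) ends s T

/-- `CC2 … T T` is `0 ≤ S(T)`. -/
lemma CC2_iff_rungSlack_nonneg (T : Finset V) :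
    CC2 p ends e s A B T T ↔ 0 ≤ rungSlack p ends e s A B T := by
  unfold CC2 rungSlack
  rw [Finset.inter_self, Finset.union_self, ← sub_nonneg]
  constructor <;> intro h <;> linarith

/-- **(MONO-u)**: `Ψ₂(T ∪ {v}) ≤ Ψ₂(T)`, cleared: `P₁(T′) S(T′) P₀(T)² ≤ P₁(T) S(T) P₀(T′)²`. -/
def MonoU (T : Finset V) (v : V) : Prop :=
  massP (Function.update p e 1) ends s (insert v T) * rungSlack p ends e s A B (insert v T) *
      massP (Function.update p e 0) ends s T ^ 2 ≤
    massP (Function.update p e 1) ends s T * rungSlack p ends e s A B T *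
      massP (Function.update p e 0) ends s (insert v T) ^ 2

/-- **(MONO-T³)**: `Ψ₃(T ∪ {v}) ≤ Ψ₃(T)`, cleared: `P₁(T′)² S(T′) P₀(T)² ≤ P₁(T)² S(T) P₀(T′)²`. -/
def MonoT3 (T : Finset V) (v : V) : Prop :=
  massP (Function.update p e 1) ends s (insert v T) ^ 2 * rungSlack p ends e s A B (insert v T) *
      massP (Function.update p e 0) ends s T ^ 2 ≤
    massP (Function.update p e 1) ends s T ^ 2 * rungSlack p ends e s A B T *
      massP (Function.update p e 0) ends s (insert v T) ^ 2

end Defs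

section Closure

variable (R : Type*) [Field R] [LinearOrder R] [IsStrictOrderedRing R]

/-- (MONO-u) over all finite graphs, weights, free edges `e = {u, w}` (`u, w ∉ T ∪ {s}`), roots,
avoided sets, targets and an ENDPOINT `v` of `e`. -/
def MonoU_all : Prop :=
  ∀ (V E : Type) [Fintype V] [DecidableEq V] [Fintype E] [DecidableEq E]
    (ends : E → Sym2 V) (p : E → R), IsProbVec p →
    ∀ (e : E) (s : V) (T : Finset V) (A B : Finset V) (v : V), s ∉ T → s ∉ ends e →
      (∀ t ∈ T, t ∉ ends e) → v ∈ ends e → v ∉ A → v ∉ B → MonoU p ends e s A B T v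

/-- (MONO-T³) over all finite graphs, weights, free edges, roots, avoided sets, targets and every
`v ∉ T ∪ {s} ∪ A ∪ B`. -/
def MonoT3_all : Prop :=
  ∀ (V E : Type) [Fintype V] [DecidableEq V] [Fintype E] [DecidableEq E]
    (ends : E → Sym2 V) (p : E → R), IsProbVec p →
    ∀ (e : E) (s : V) (T : Finset V) (A B : Finset V) (v : V), s ∉ T → s ∉ ends e →
      (∀ t ∈ T, t ∉ ends e) → v ∉ T → v ≠ s → v ∉ A → v ∉ B → MonoT3 p ends e s A B T v

end Closure

end MonoT

end Summit.Ventures.PercRepro2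

/-! ## Status (2026-08-23, typer-1 g7; lead ASSIGNMENTS v11.12 typer item (3))

Both rows are REFUTED as weighted statements (conjectures/NEGATIVE.md NEG-73, NEG-74); the
definitions stay as the record of what was tested, and the identities and reductions built on them
stand.

* `MonoU_all` is FALSE — NEG-73 (mine-c g5 13:57:30Z, lead re-check `recheck20.py` exact):
  `c8_01200` (edges 03 14 17 25 27 34 36 47 56 57 67) plus a pendant leaf `ℓ = 8` at vertex `0`,
  `e = (0, 8)`, `s = 7`, `A = {1}`, `B = {2}`, `T = ∅`, `v = u = 0`, NEG-72's weights (leaf weight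
  `q = 1/128`, also `1/256`, on `03`): every hypothesis of `MonoU_all` holds and the cleared inequality
  `P₁(T′) S(T′) P₀(T)² ≤ P₁(T) S(T) P₀(T′)²` FAILS (`LHS − RHS > 0`). A pendant new leaf leaves the
  law on the old graph unchanged, so there `P₁ = P₀ = P`, `S(T) = P(T)·D(T)` and
  `LHS − RHS = P(T)² P(T′)² (D(T′) − D(T))` — the failure is NEG-72's `D(∅) < D({0})`.
* `MonoT3_all` is FALSE — NEG-74 (mine-c g5 14:08:11Z, two implementations; lead re-check
  `recheck21.py` exact): `c8_01200`, `e = (0, 3)`, `s = 7`, `A = {1}`, `B = {2}`, `T = ∅ → {0}`,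
  `v = 0`, weights `(1,4) 1/16, (1,7) 15/16, (2,5) 1/8, (2,7) 7/8, (3,4) = (3,6) = α, (4,7) 15/16,
  (5,6) 1/8, (5,7) 7/8, (6,7) 7/8`: the cleared slack is `≈ −3.570·10⁻¹⁴` at `α = 1/128`
  (negative also at `1/256`, `1/1024`; positive at `1/32`, `1/64`). Moreover no power `P₁^k` of
  the avoidance probability makes the BHK slack monotone in the avoided set (NEG-74 (2b),
  `k = 2 … 6`).

What stands: `rungSlack`, `CC2_iff_rungSlack_nonneg`, and the reductions `MonoT.CC2_of_monoU`
(`MonoTReduction.lean`: (MONO-u) at the edge + the avoided-edge rung ⟹ (CC-T)) and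
`MonoT.CC2_of_monoU_of_pos` (`MonoTPos.lean`) — implications whose hypothesis is now known to fail
in general. The rung (CC-T) itself (`TwoSetRung.CC2`, row 2′CCT) is untouched by NEG-73/74
(0 violations in the same α-family sweeps, NEG-74 second implementation).
-/
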